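import Mathlib.RepresentationTheory.Intertwining
import Mathlib.LinearAlgebra.Prod
import HarnessLib

/-!
# First-order deformations of a representation and the sign endomorphism of the jet module («JET-SIGN»)

Generic representation theory over a commutative ring `k` (any monoid `G`), Mathlib-only (`Representation k G V`,
`Representation.IntertwiningMap`), THEOREMS ONLY (no `def`, no instance, no named fact).

THE SITUATION.  A one-parameter family of representations `π_s` of `G` on ONE module `V` («compact picture»), read to first
order in `s`: `π_s = π₀ + s π₁ (mod s²)`.  Multiplicativity mod `s²` says that `π₀ : Representation k G V` and that the
derivative `π₁ : G → End_k V` is a DERIVATION along `π₀`: `π₁ (g h) = π₁ g ∘ π₀ h + π₀ g ∘ π₁ h`, `π₁ 1 = 0` — a «first-order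
deformation pair».  The module `V[s] ∕ s² = V ⊕ s V` with the action `π₀ + s π₁` is the JET MODULE `Ĩ`: on `V × V`,
`g · (v₀, v₁) = (π₀ g v₀, π₁ g v₀ + π₀ g v₁)`; it is an extension `0 → (V, π₀) → Ĩ → (V, π₀) → 0` (sub `0 × V = s V`,
quotient by the first projection).  A family of intertwining operators `𝒜(s) : (V, π_s) → (V, π_{-s})` read to first order,
`𝒜(s) = 𝒜₀ + s 𝒜₁`, is a JET INTERTWINER: `𝒜₀ ∈ End_G(V, π₀)` and
`𝒜₁ ∘ π₀ g - π₀ g ∘ 𝒜₁ = -(π₁ g ∘ 𝒜₀ + 𝒜₀ ∘ π₁ g)` (the order-`s` term of `𝒜(s) π_s(g) = π_{-s}(g) 𝒜(s)`).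

* §1 `exists_representation_jet`: a first-order deformation pair defines the jet representation on `V × V`; the inclusion
  `v ↦ (0, v)` and the projection `fst` are equivariant (`jet_apply_zero_left`, `fst_jet_apply`), so `Ĩ` is an extension of
  `(V, π₀)` by `(V, π₀)`.
* §2 **`jet_sign_intertwines`**: a jet intertwiner `(𝒜₀, 𝒜₁)` yields the `G`-ENDOMORPHISM
  `Φ (v₀, v₁) = (𝒜₀ v₀, -(𝒜₁ v₀ + 𝒜₀ v₁))` of `Ĩ` (it is `τ ∘ 𝒜(s)` with `τ : s ↦ -s`, which is `-1` on `s V` and `+1` on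
  `V ∕ s V`), packaged as a Mathlib `IntertwiningMap` (`exists_intertwiningMap_jet_sign`); `Φ` preserves the sub `0 × V`, acts
  there by `-𝒜₀`, and induces `+𝒜₀` on the quotient (`jet_sign_apply_zero_left`, `fst_jet_sign_apply`).  When `𝒜₀` is a
  non-scalar involution (`+1` on `π⁺`, `-1` on `π⁻`) this is the endomorphism acting by OPPOSITE SIGNS on the sub and
  quotient copies of a constituent — the input of the splitting lemma «an extension with such an endomorphism splits»
  (the tree's `IntertwiningMapEigenSplitting` ∕ `ExtensionSplitting`).
* §3 bookkeeping converses: the Leibniz rule IS multiplicativity of `π₀ + s π₁` mod `s²` (`jet_mul`), and the jet-intertwiner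
  relation IS the order-`s` identity (`jet_sign_intertwines_iff`).
* §4 CONSEQUENCE («`e₊₊ = 0`»): on a `+1`-eigenvector of `𝒜₀` the jet relation reads
  `(1 + 𝒜₀)(π₁ g v) = π₀ g (𝒜₁ v) - 𝒜₁ (π₀ g v)` (`add_jet_apply_of_eigen_one`; `-1`-twin `sub_jet_apply_of_eigen_neg_one`): with
  `𝒜₀² = 1` and `2` invertible the `π⁺`-block of the deformation cocycle `π₁` on `π⁺ = ker (𝒜₀ - 1)` is the COBOUNDARY of
  `¼ (1 + 𝒜₀) 𝒜₁` (`half_add_jet_apply_eq_coboundary`) — the self-extension of `π⁺` by `π⁺` cut out of the jet module by `𝒜₀`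
  SPLITS — while the `π⁺ → π⁻` block of `𝒜₁` is merely equivariant (`sub_apply_jet_off_diagonal`): the jet constrains the
  diagonal blocks only.

What stays OUTSIDE this file (and in print where it is used): the EXISTENCE of `𝒜₁`, i.e. the regularity at `s = 0` of a
normalised intertwining operator — an analytic statement; here `(𝒜₀, 𝒜₁)` are hypotheses.

SOURCES (what is formalised, read at our letters).  The jet module `V[s]∕s²` of a family `π_s` and the first-order expansion of
an intertwining relation are standard first-order deformation bookkeeping; for the representation-theoretic context (normalised
intertwining operators `𝒜(w, χ ν^s)` of induced representations, holomorphic and non-scalar at a reducibility point `s = 0` of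
the unitary axis, the `R`-group) see [Keys1984, §3 pp. 118–119] (the operators `A(w, λ_s)`, their normalisation `U(w, λ)`
and cocycle relation, the `c`-functions and Plancherel measure) and [Keys1984, §4 Thm. 3 p. 120; Remark p. 129] (the commuting
algebra of the unitary principal series is `ℂ[R]`, spanned by the normalised self-intertwining operators, which give the
projections onto the constituents — for `U(3)` an involution `𝒜(w, χ)` with eigenvalues `±1` on the two constituents), and
[Rogawski1990, §12.2 (3) p. 173] (the l.d.s. packets `{π₁(θ), π₂(θ)} = JH(i_B(θ̃))`).  The algebra below is self-contained and
cites these only as the locus of its consumer.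
-/

set_option autoImplicit false

namespace Literature.RepresentationTheory

variable {k : Type*} [CommRing k] {G : Type*} [Monoid G] {V : Type*} [AddCommGroup V] [Module k V]

/-! ## §1 The jet representation of a first-order deformation pair -/

/-- **THE JET REPRESENTATION.**  A first-order deformation pair `(π₀, π₁)` — `π₁ 1 = 0` and the Leibniz rule
`π₁ (g h) = π₁ g ∘ π₀ h + π₀ g ∘ π₁ h` — defines a representation of `G` on `V × V` by
`g · (v₀, v₁) = (π₀ g v₀, π₁ g v₀ + π₀ g v₁)` (the module `V[s]∕s²` with the action `π₀ + s π₁`).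
[cite: Keys1984, §3 pp. 118–119] -/
theorem exists_representation_jet (π₀ : Representation k G V) (π₁ : G → Module.End k V) (h1 : π₁ 1 = 0)
    (hL : ∀ g h, π₁ (g * h) = π₁ g * π₀ h + π₀ g * π₁ h) :
    ∃ ρ : Representation k G (V × V), ∀ g v₀ v₁, ρ g (v₀, v₁) = (π₀ g v₀, π₁ g v₀ + π₀ g v₁) := by
  let M : G → (V × V) →ₗ[k] (V × V) := fun g =>
    LinearMap.prod (π₀ g ∘ₗ LinearMap.fst k V V) (π₁ g ∘ₗ LinearMap.fst k V V + π₀ g ∘ₗ LinearMap.snd k V V)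
  have hM : ∀ g v₀ v₁, M g (v₀, v₁) = (π₀ g v₀, π₁ g v₀ + π₀ g v₁) := fun g v₀ v₁ => rfl
  refine ⟨{ toFun := M, map_one' := ?_, map_mul' := fun g h => ?_ }, fun g v₀ v₁ => rfl⟩
  · apply LinearMap.ext
    rintro ⟨v₀, v₁⟩
    rw [hM, map_one, h1, Module.End.one_apply, Module.End.one_apply, LinearMap.zero_apply, zero_add,
      Module.End.one_apply]
  · apply LinearMap.ext
    rintro ⟨v₀, v₁⟩
    rw [Module.End.mul_apply, hM, hM, hM, map_mul, hL, Module.End.mul_apply]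
    refine Prod.ext rfl ?_
    simp only [LinearMap.add_apply, Module.End.mul_apply, map_add]
    abel

/-- The inclusion of the SUB: `g · (0, v) = (0, π₀ g v)` — the second factor `0 × V` (`= s V`) is a copy of `(V, π₀)`.
[cite: Keys1984, §3 pp. 118–119] -/
theorem jet_apply_zero_left (π₀ : Representation k G V) (π₁ : G → Module.End k V) (ρ : Representation k G (V × V))
    (hρ : ∀ g v₀ v₁, ρ g (v₀, v₁) = (π₀ g v₀, π₁ g v₀ + π₀ g v₁)) (g : G) (v : V) :
    ρ g (0, v) = (0, π₀ g v) := by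
  rw [hρ, map_zero, map_zero, zero_add]

/-- The projection to the QUOTIENT: `fst (g · (v₀, v₁)) = π₀ g v₀` — the first projection is equivariant onto `(V, π₀)`, with
kernel the sub `0 × V`. [cite: Keys1984, §3 pp. 118–119] -/
theorem fst_jet_apply (π₀ : Representation k G V) (π₁ : G → Module.End k V) (ρ : Representation k G (V × V))
    (hρ : ∀ g v₀ v₁, ρ g (v₀, v₁) = (π₀ g v₀, π₁ g v₀ + π₀ g v₁)) (g : G) (v : V × V) :
    (ρ g v).1 = π₀ g v.1 := by
  obtain ⟨v₀, v₁⟩ := v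
  rw [hρ]

/-- The sub `0 × V` is `ρ`-stable (as a submodule: `Submodule.prod ⊥ ⊤`). [cite: Keys1984, §3 pp. 118–119] -/
theorem prod_bot_top_le_comap_jet (π₀ : Representation k G V) (π₁ : G → Module.End k V)
    (ρ : Representation k G (V × V)) (hρ : ∀ g v₀ v₁, ρ g (v₀, v₁) = (π₀ g v₀, π₁ g v₀ + π₀ g v₁)) (g : G) :
    (Submodule.prod (⊥ : Submodule k V) (⊤ : Submodule k V)) ≤ (Submodule.prod ⊥ ⊤).comap (ρ g) := by
  rintro ⟨v₀, v₁⟩ hv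
  rw [Submodule.mem_prod, Submodule.mem_bot] at hv
  obtain ⟨rfl, -⟩ := hv
  rw [Submodule.mem_comap, jet_apply_zero_left π₀ π₁ ρ hρ, Submodule.mem_prod, Submodule.mem_bot]
  exact ⟨rfl, Submodule.mem_top⟩

/-! ## §2 A jet intertwiner gives the sign endomorphism `Φ = τ ∘ 𝒜(s)` of the jet module -/

/-- **THE SIGN ENDOMORPHISM INTERTWINES.**  Let `(π₀, π₁)` define the jet representation `ρ` and let `(𝒜₀, 𝒜₁)` be a jet
intertwiner: `𝒜₀` commutes with `π₀` and `𝒜₁ ∘ π₀ g - π₀ g ∘ 𝒜₁ = -(π₁ g ∘ 𝒜₀ + 𝒜₀ ∘ π₁ g)` for all `g`.  Then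
`Φ (v₀, v₁) := (𝒜₀ v₀, -(𝒜₁ v₀ + 𝒜₀ v₁))` commutes with every `ρ g`. [cite: Keys1984, §4 Thm. 3 p. 120 and Remark p. 129]
[cite: Rogawski1990, §12.2 (3) p. 173] -/
theorem jet_sign_intertwines (π₀ : Representation k G V) (π₁ : G → Module.End k V) (ρ : Representation k G (V × V))
    (hρ : ∀ g v₀ v₁, ρ g (v₀, v₁) = (π₀ g v₀, π₁ g v₀ + π₀ g v₁)) (A₀ A₁ : Module.End k V)
    (hA₀ : ∀ g, A₀ * π₀ g = π₀ g * A₀) (hA₁ : ∀ g, A₁ * π₀ g - π₀ g * A₁ = -(π₁ g * A₀ + A₀ * π₁ g)) (g : G)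
    (v₀ v₁ : V) :
    ρ g (A₀ v₀, -(A₁ v₀ + A₀ v₁)) = (A₀ (π₀ g v₀), -(A₁ (π₀ g v₀) + A₀ (π₁ g v₀ + π₀ g v₁))) := by
  have h0 : π₀ g (A₀ v₀) = A₀ (π₀ g v₀) := by
    rw [← Module.End.mul_apply, ← hA₀, Module.End.mul_apply]
  have h0' : π₀ g (A₀ v₁) = A₀ (π₀ g v₁) := by
    rw [← Module.End.mul_apply, ← hA₀, Module.End.mul_apply]
  have h1 : A₁ (π₀ g v₀) - π₀ g (A₁ v₀) = -(π₁ g (A₀ v₀) + A₀ (π₁ g v₀)) := by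
    have := congrArg (fun T : Module.End k V => T v₀) (hA₁ g)
    simpa only [LinearMap.sub_apply, Module.End.mul_apply, LinearMap.neg_apply, LinearMap.add_apply] using this
  rw [hρ, h0]
  refine Prod.ext rfl ?_
  dsimp only
  rw [map_neg, map_add, map_add, h0']
  -- goal: π₁ g (A₀ v₀) + -(π₀ g (A₁ v₀) + A₀ (π₀ g v₁)) = -(A₁ (π₀ g v₀) + (A₀ (π₁ g v₀) + A₀ (π₀ g v₁)))
  have h2 : A₁ (π₀ g v₀) = -(π₁ g (A₀ v₀) + A₀ (π₁ g v₀)) + π₀ g (A₁ v₀) := sub_eq_iff_eq_add.mp h1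
  rw [h2]
  abel

/-- **PACKAGED AS AN INTERTWINING MAP.**  Under the hypotheses of `jet_sign_intertwines` there is a Mathlib
`IntertwiningMap ρ ρ` acting by `(v₀, v₁) ↦ (𝒜₀ v₀, -(𝒜₁ v₀ + 𝒜₀ v₁))`.
[cite: Keys1984, §4 Thm. 3 p. 120 and Remark p. 129] [cite: Rogawski1990, §12.2 (3) p. 173] -/
theorem exists_intertwiningMap_jet_sign (π₀ : Representation k G V) (π₁ : G → Module.End k V)
    (ρ : Representation k G (V × V)) (hρ : ∀ g v₀ v₁, ρ g (v₀, v₁) = (π₀ g v₀, π₁ g v₀ + π₀ g v₁))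
    (A₀ A₁ : Module.End k V) (hA₀ : ∀ g, A₀ * π₀ g = π₀ g * A₀)
    (hA₁ : ∀ g, A₁ * π₀ g - π₀ g * A₁ = -(π₁ g * A₀ + A₀ * π₁ g)) :
    ∃ Φ : ρ.IntertwiningMap ρ, ∀ v₀ v₁, Φ (v₀, v₁) = (A₀ v₀, -(A₁ v₀ + A₀ v₁)) := by
  let L : (V × V) →ₗ[k] (V × V) :=
    LinearMap.prod (A₀ ∘ₗ LinearMap.fst k V V) (-(A₁ ∘ₗ LinearMap.fst k V V + A₀ ∘ₗ LinearMap.snd k V V))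
  have hL : ∀ v₀ v₁, L (v₀, v₁) = (A₀ v₀, -(A₁ v₀ + A₀ v₁)) := fun v₀ v₁ => rfl
  refine ⟨L.intertwiningMap_of_isIntertwiningMap ρ ρ ?_, fun v₀ v₁ => rfl⟩
  rintro g ⟨v₀, v₁⟩
  rw [hρ, hL, hL, jet_sign_intertwines π₀ π₁ ρ hρ A₀ A₁ hA₀ hA₁]

/-- `Φ` PRESERVES THE SUB and acts there by `-𝒜₀`: `Φ (0, v) = (0, -𝒜₀ v)`. [cite: Keys1984, §4 Thm. 3 p. 120 and Remark p. 129] -/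
theorem jet_sign_apply_zero_left (A₀ A₁ : Module.End k V) (v : V) :
    ((A₀ (0 : V), -(A₁ (0 : V) + A₀ v)) : V × V) = (0, -A₀ v) := by
  rw [map_zero, map_zero, zero_add]

/-- `Φ` INDUCES `+𝒜₀` ON THE QUOTIENT: `fst (Φ (v₀, v₁)) = 𝒜₀ v₀ = 𝒜₀ (fst (v₀, v₁))`.  So when `𝒜₀` is an involution that is
`+1` on a constituent `π⁺` and `-1` on its complement, `Φ` acts by OPPOSITE signs on the sub and quotient copies of `π⁺` — the
input of the eigen-splitting lemma. [cite: Keys1984, §4 Thm. 3 p. 120 and Remark p. 129] [cite: Rogawski1990, §12.2 (3) p. 173] -/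
theorem fst_jet_sign_apply (A₀ A₁ : Module.End k V) (v : V × V) :
    ((A₀ v.1, -(A₁ v.1 + A₀ v.2)) : V × V).1 = A₀ v.1 := rfl

/-- The sign endomorphism squares to `(𝒜₀² v₀, (𝒜₀ 𝒜₁ - 𝒜₁ 𝒜₀) v₀ + 𝒜₀² v₁)`; in particular if `𝒜₀² = 1` and `𝒜₁` COMMUTES with
`𝒜₀` (the two first-order consequences of the functional equation `𝒜(-s) 𝒜(s) = 1`) then `Φ² = 1`. [cite: Keys1984, §4 Thm. 3 p. 120 and Remark p. 129] -/
theorem jet_sign_apply_jet_sign (A₀ A₁ : Module.End k V) (v₀ v₁ : V) :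
    ((A₀ (A₀ v₀), -(A₁ (A₀ v₀) + A₀ (-(A₁ v₀ + A₀ v₁)))) : V × V) =
      ((A₀ * A₀) v₀, (A₀ * A₁ - A₁ * A₀) v₀ + (A₀ * A₀) v₁) := by
  refine Prod.ext rfl ?_
  simp only [Module.End.mul_apply, LinearMap.sub_apply, map_neg, map_add]
  abel

/-! ## §3 Bookkeeping converses: Leibniz = multiplicativity mod `s²`, jet relation = order-`s` intertwining -/

/-- **LEIBNIZ ⟺ MULTIPLICATIVITY mod `s²`**, read on `V × V`: for maps `π₀ π₁ : G → End V`, the block operators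
`J g (v₀, v₁) := (π₀ g v₀, π₁ g v₀ + π₀ g v₁)` satisfy `J (g h) = J g ∘ J h` on all vectors iff `π₀ (g h) = π₀ g ∘ π₀ h` and
`π₁ (g h) = π₁ g ∘ π₀ h + π₀ g ∘ π₁ h` (evaluate at `(v, 0)`). [cite: Keys1984, §3 pp. 118–119] -/
theorem jet_mul_iff (π₀ π₁ : G → Module.End k V) (g h : G) :
    (∀ v₀ v₁ : V, ((π₀ (g * h) v₀, π₁ (g * h) v₀ + π₀ (g * h) v₁) : V × V) =
        (π₀ g (π₀ h v₀), π₁ g (π₀ h v₀) + π₀ g (π₁ h v₀ + π₀ h v₁))) ↔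
      π₀ (g * h) = π₀ g * π₀ h ∧ π₁ (g * h) = π₁ g * π₀ h + π₀ g * π₁ h := by
  constructor
  · intro H
    have H0 : ∀ v, π₀ (g * h) v = π₀ g (π₀ h v) := fun v => congrArg Prod.fst (H v 0)
    refine ⟨LinearMap.ext fun v => by rw [H0, Module.End.mul_apply], LinearMap.ext fun v => ?_⟩
    have := congrArg Prod.snd (H v 0)
    simp only [map_zero, add_zero] at this
    rw [this, LinearMap.add_apply, Module.End.mul_apply, Module.End.mul_apply]
  · rintro ⟨H0, H1⟩ v₀ v₁
    refine Prod.ext ?_ ?_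
    · simp only [H0, Module.End.mul_apply]
    · simp only [H0, H1, LinearMap.add_apply, Module.End.mul_apply, map_add]
      abel

omit [Monoid G] in
/-- **JET RELATION ⟺ ORDER-`s` INTERTWINING**: for `𝒜₀` commuting with `π₀ g`, the map
`(v₀, v₁) ↦ (𝒜₀ v₀, 𝒜₁ v₀ + 𝒜₀ v₁)` (= `𝒜₀ + s 𝒜₁` on `V[s]∕s²`) carries the `π_s`-jet action `(π₀, π₁)` to the `π_{-s}`-jet
action `(π₀, -π₁)` at `g` iff `𝒜₁ ∘ π₀ g - π₀ g ∘ 𝒜₁ = -(π₁ g ∘ 𝒜₀ + 𝒜₀ ∘ π₁ g)`. [cite: Keys1984, §4 Thm. 3 p. 120 and Remark p. 129] -/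
theorem jet_relation_iff (π₀ π₁ : G → Module.End k V) (A₀ A₁ : Module.End k V) (g : G)
    (hA₀ : A₀ * π₀ g = π₀ g * A₀) :
    (∀ v₀ v₁ : V, ((A₀ (π₀ g v₀), A₁ (π₀ g v₀) + A₀ (π₁ g v₀ + π₀ g v₁)) : V × V) =
        (π₀ g (A₀ v₀), -(π₁ g (A₀ v₀)) + π₀ g (A₁ v₀ + A₀ v₁))) ↔
      A₁ * π₀ g - π₀ g * A₁ = -(π₁ g * A₀ + A₀ * π₁ g) := by
  have h0 : ∀ v, π₀ g (A₀ v) = A₀ (π₀ g v) := fun v => by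
    rw [← Module.End.mul_apply, ← hA₀, Module.End.mul_apply]
  constructor
  · intro H
    ext v
    have := congrArg Prod.snd (H v 0)
    simp only [map_zero, add_zero] at this
    -- this : A₁ (π₀ g v) + A₀ (π₁ g v) = -(π₁ g (A₀ v)) + π₀ g (A₁ v)
    simp only [LinearMap.sub_apply, Module.End.mul_apply, LinearMap.neg_apply, LinearMap.add_apply]
    rw [sub_eq_iff_eq_add, eq_sub_of_add_eq this]
    abel
  · intro H v₀ v₁
    refine Prod.ext (h0 v₀).symm ?_
    have := congrArg (fun T : Module.End k V => T v₀) H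
    simp only [LinearMap.sub_apply, Module.End.mul_apply, LinearMap.neg_apply, LinearMap.add_apply] at this
    dsimp only
    rw [map_add, map_add, h0 v₁]
    -- this : A₁ (π₀ g v₀) - π₀ g (A₁ v₀) = -(π₁ g (A₀ v₀) + A₀ (π₁ g v₀))
    have h2 : A₁ (π₀ g v₀) = -(π₁ g (A₀ v₀) + A₀ (π₁ g v₀)) + π₀ g (A₁ v₀) := sub_eq_iff_eq_add.mp this
    rw [h2]
    abel

/-! ## §4 Consequence: on the `±1`-eigenspaces of `𝒜₀` the diagonal blocks of `π₁` are coboundaries («`e₊₊ = 0`») -/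

section DiagonalBlocks

/-- **JET IDENTITY ON THE `+1`-EIGENSPACE.**  For a jet intertwiner `(𝒜₀, 𝒜₁)` and a vector with `𝒜₀ v = v`:
`(1 + 𝒜₀) (π₁ g v) = π₀ g (𝒜₁ v) - 𝒜₁ (π₀ g v)` — the `(1 + 𝒜₀)`-part of the deformation cocycle `π₁` on `ker (𝒜₀ - 1)` is the
coboundary of `𝒜₁`.  (Evaluate the jet relation at `v`.) [cite: Keys1984, §4 Thm. 3 p. 120 and Remark p. 129] -/
theorem add_jet_apply_of_eigen_one (π₀ : Representation k G V) (π₁ : G → Module.End k V) (A₀ A₁ : Module.End k V)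
    (hA₁ : ∀ g, A₁ * π₀ g - π₀ g * A₁ = -(π₁ g * A₀ + A₀ * π₁ g)) (g : G) {v : V} (hv : A₀ v = v) :
    π₁ g v + A₀ (π₁ g v) = π₀ g (A₁ v) - A₁ (π₀ g v) := by
  have h := congrArg (fun T : Module.End k V => T v) (hA₁ g)
  simp only [LinearMap.sub_apply, Module.End.mul_apply, LinearMap.neg_apply, LinearMap.add_apply, hv] at h
  -- h : A₁ (π₀ g v) - π₀ g (A₁ v) = -(π₁ g v + A₀ (π₁ g v))
  have h' := congrArg Neg.neg h
  rw [neg_neg, neg_sub] at h'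
  exact h'.symm

/-- **JET IDENTITY ON THE `-1`-EIGENSPACE.**  For `𝒜₀ v = -v`: `(1 - 𝒜₀) (π₁ g v) = 𝒜₁ (π₀ g v) - π₀ g (𝒜₁ v)`.
[cite: Keys1984, §4 Thm. 3 p. 120 and Remark p. 129] -/
theorem sub_jet_apply_of_eigen_neg_one (π₀ : Representation k G V) (π₁ : G → Module.End k V) (A₀ A₁ : Module.End k V)
    (hA₁ : ∀ g, A₁ * π₀ g - π₀ g * A₁ = -(π₁ g * A₀ + A₀ * π₁ g)) (g : G) {v : V} (hv : A₀ v = -v) :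
    π₁ g v - A₀ (π₁ g v) = A₁ (π₀ g v) - π₀ g (A₁ v) := by
  have h := congrArg (fun T : Module.End k V => T v) (hA₁ g)
  simp only [LinearMap.sub_apply, Module.End.mul_apply, LinearMap.neg_apply, LinearMap.add_apply, hv, map_neg] at h
  -- h : A₁ (π₀ g v) - π₀ g (A₁ v) = -(-(π₁ g v) + A₀ (π₁ g v))
  rw [h]
  abel

/-- **THE OFF-DIAGONAL BLOCK IS EQUIVARIANT.**  If moreover `𝒜₀² = 1` and `𝒜₀` commutes with `π₀ g`, then for `𝒜₀ v = v` the
`(1 - 𝒜₀)`-part of `𝒜₁` intertwines: `(1 - 𝒜₀) (𝒜₁ (π₀ g v)) = π₀ g ((1 - 𝒜₀) (𝒜₁ v))` (apply `1 - 𝒜₀` to the jet identity: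
`(1 - 𝒜₀)(1 + 𝒜₀) = 0`) — the jet relation puts NO constraint on the `π⁺ → π⁻` block, which is where the non-split content
lives. [cite: Keys1984, §4 Thm. 3 p. 120 and Remark p. 129] -/
theorem sub_apply_jet_off_diagonal (π₀ : Representation k G V) (π₁ : G → Module.End k V) (A₀ A₁ : Module.End k V)
    (hA₀ : ∀ g, A₀ * π₀ g = π₀ g * A₀) (hsq : A₀ * A₀ = 1)
    (hA₁ : ∀ g, A₁ * π₀ g - π₀ g * A₁ = -(π₁ g * A₀ + A₀ * π₁ g)) (g : G) {v : V} (hv : A₀ v = v) :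
    A₁ (π₀ g v) - A₀ (A₁ (π₀ g v)) = π₀ g (A₁ v) - A₀ (π₀ g (A₁ v)) := by
  have h := add_jet_apply_of_eigen_one π₀ π₁ A₀ A₁ hA₁ g hv
  -- apply `A₀` to h and use `A₀² = 1`, `A₀ π₀ = π₀ A₀`
  have hA := congrArg (fun w => A₀ w) h
  have hsq' : ∀ w, A₀ (A₀ w) = w := fun w => by rw [← Module.End.mul_apply, hsq, Module.End.one_apply]
  have hc : ∀ w, A₀ (π₀ g w) = π₀ g (A₀ w) := fun w => by rw [← Module.End.mul_apply, hA₀, Module.End.mul_apply]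
  simp only [map_add, map_sub, hsq'] at hA
  -- hA : A₀ (π₁ g v) + π₁ g v = A₀ (π₀ g (A₁ v)) - A₀ (A₁ (π₀ g v))
  rw [hc] at hA ⊢
  have e : π₀ g (A₁ v) - A₁ (π₀ g v) = π₀ g (A₀ (A₁ v)) - A₀ (A₁ (π₀ g v)) := by
    rw [← h, ← hA, add_comm]
  -- rearrange `e`
  have := sub_eq_sub_iff_sub_eq_sub.mp e
  rw [← neg_sub, this, neg_sub]

/-- **«`e₊₊ = 0`»: THE `π⁺`-BLOCK OF THE DEFORMATION COCYCLE IS A COBOUNDARY.**  With `𝒜₀² = 1`, `𝒜₀` commuting with `π₀`, the jet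
relation and `2` invertible: for `𝒜₀ v = v`, writing `P = 1 + 𝒜₀` (so `½ P` is the projector onto `π⁺ = ker (𝒜₀ - 1)` along
`π⁻`) and `t := ¼ · P ∘ 𝒜₁`, one has `½ P (π₁ g v) = π₀ g (t v) - t (π₀ g v)`: the class of the self-extension of `π⁺` by `π⁺` cut
out of the jet module by `𝒜₀` VANISHES.  (In the l.d.s. application this is `Ext¹_G(π⁺, π⁺) ∋ e₊₊ = 0`, the step that — with
`(e₊₊, e₊₋) ≠ 0` from Frobenius — gives `⟨χ_{π⁺}, χ_{π⁺}⟩_e = 1`.) [cite: Keys1984, §4 Thm. 3 p. 120 and Remark p. 129]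
[cite: Rogawski1990, §12.2 (3) p. 173] -/
theorem half_add_jet_apply_eq_coboundary [Invertible (2 : k)] (π₀ : Representation k G V) (π₁ : G → Module.End k V)
    (A₀ A₁ : Module.End k V) (hA₀ : ∀ g, A₀ * π₀ g = π₀ g * A₀) (hsq : A₀ * A₀ = 1)
    (hA₁ : ∀ g, A₁ * π₀ g - π₀ g * A₁ = -(π₁ g * A₀ + A₀ * π₁ g)) (g : G) {v : V} (hv : A₀ v = v) :
    (⅟(2 : k) • (1 + A₀)) (π₁ g v) =
      π₀ g (((⅟(2 : k) * ⅟(2 : k)) • ((1 + A₀) * A₁)) v) - ((⅟(2 : k) * ⅟(2 : k)) • ((1 + A₀) * A₁)) (π₀ g v) := by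
  have h := add_jet_apply_of_eigen_one π₀ π₁ A₀ A₁ hA₁ g hv
  have hsq' : ∀ w, A₀ (A₀ w) = w := fun w => by rw [← Module.End.mul_apply, hsq, Module.End.one_apply]
  have hc : ∀ w, A₀ (π₀ g w) = π₀ g (A₀ w) := fun w => by rw [← Module.End.mul_apply, hA₀, Module.End.mul_apply]
  -- apply `1 + A₀` to `h`: `(1 + A₀)² π₁ g v = 2 (1 + A₀) π₁ g v = π₀ g ((1+A₀) A₁ v) - (1 + A₀) A₁ (π₀ g v)`
  have h2 : (2 : k) • (π₁ g v + A₀ (π₁ g v)) = π₀ g (A₁ v + A₀ (A₁ v)) - (A₁ (π₀ g v) + A₀ (A₁ (π₀ g v))) := by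
    have hA := congrArg (fun w => A₀ w) h
    simp only [map_add, map_sub, hsq', hc] at hA
    -- hA : A₀ (π₁ g v) + π₁ g v = π₀ g (A₀ (A₁ v)) - A₀ (A₁ (π₀ g v))
    rw [two_smul]
    nth_rewrite 1 [h]
    rw [add_comm (π₁ g v) (A₀ (π₁ g v)), hA, map_add]
    abel
  -- divide by 4
  simp only [LinearMap.smul_apply, LinearMap.add_apply, Module.End.one_apply, Module.End.mul_apply, map_smul]
  rw [← smul_sub, ← h2, smul_smul, mul_assoc, invOf_mul_self, mul_one]

end DiagonalBlocks

end Literature.RepresentationTheory
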